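import Mathlib
import HarnessLib
import Summits.HubbardSuperconductivity.HubbardSuperconductivity.Theorems.KLProgrammeCutCurrencyFirstMomentBound
import Summits.HubbardSuperconductivity.HubbardSuperconductivity.Theorems.KLProgrammeCutCurrencyLegMassNumeric
import Summits.HubbardSuperconductivity.HubbardSuperconductivity.Theorems.KLProgrammeCutCurrencyWeightedCurrency

/-!
# Route `KLProgramme` — ENGINE (stmt-HubbardSuperconductivity-20437 `KLRegimeEngineV17F2`), located #25 «(b)-PLAIN-UV-TAIL», cure (α),
# E1 item (i) towards the WEIGHTED rows, THE NUMBERS: `M₁ ≤ 2·10⁴` and the first-moment currency of `S_ĝ V` `≤ (|U|/24)·5.4·10⁸`, UNIFORMLY in `128 ≤ β ≤ M`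
# (cell gate-hubbard-kl, seat hubbard-kl-k3c2-p2 g35)

* `klct_legTransform_uvCut_le_support` — `|ĉ(j)| ≤ β/(8π) + 1` for every `j` (`0 < β`);
* `klct_legFirstMoment_uvCut_le_support` — `M₁ ≤ β(β/(8π)+1)/2` (`d ≤ M`);
* **`klct_legFirstMoment_uvCut_le_numeric`** — `M₁ := (2M)⁻¹Σ_j (β·d_{2M}(j)/2M)|ĉ(j)| ≤ 20000` for `128 ≤ β ≤ M` (`β ≤ 900`: support bound;
  `β ≥ 900`: `klct_legFirstMoment_uvCut_le` at `J = ⌈672M/β⌉`: `113401·S/β ≤ 4700`, `β²C₃/10752 = K₃(1.5π² + 128π³/β)/10752 ≤ 11800`);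
* **`klbv_firstMomentCurrency_uvCut_hubbardInteraction_le_numeric`** — for `128 ≤ β ≤ M`, every `L`, `U`, `q`, `y`:
  `ε_x³ Σ_{x′ : x′_q = y} (Σ_i (β/2M)·d_{2M}(t′_i − t′_q))·‖W₄(S_ĝ V)(x′)‖ ≤ (|U|/24)·(8·20000·15³)` — the β/M-UNIFORM TREE-WEIGHT (first time moment) datum
  for the cut plain quartic row of binder #6 at the vertex pattern, modulo the `klScaleWt`/`gridLabelDist` plumbing.  HONEST LABEL: the constants are NOT optimised
  (truth [float-scale] `A ≈ 1.4`, `M₁ = O(30)`): the Cauchy row `|σ‴| ≤ 5391`, sup-norm (not `L¹`) derivative inputs, the two-region split and the factor-2 mean-value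
  steps cost ≈ 10³; the qualitative content is the β- and `M`-UNIFORMITY with explicit numerals.
No definition; nothing asserts any row, (b), (C), K3, U₀, the window or superconductivity.
References: BGM 2006 §2.2–2.3, §3 [cite: BenfattoGiulianiMastropietro2006].
-/

noncomputable section

namespace Summit.HubbardSuperconductivity.HubbardSuperconductivity.Theorems.KLRegimeSplit

set_option linter.dupNamespace false -- summit = problem name (single-conjunct summit), D-0017

open Finset Literature.MathematicalPhysics.QuantumLattice Literature.Probability.LatticeModels GrassmannAlgebra

variable {L M : ℕ} [NeZero M]

/-! ## §1 Support bounds -/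

omit [NeZero M] in
/-- `|ĉ(j)| ≤ β/(8π) + 1` for every `j` (`0 < β`). -/
theorem klct_legTransform_uvCut_le_support {β : ℝ} (hβ : 0 < β) (j : ImagTimeIdx M) :
    ‖∑ n : MatsubaraIdx M, (((gnScaleCutoff 4 klE0 1 |matsubaraFreq β M n| : ℝ) : ℂ)) *
        Complex.exp (-((2 * Real.pi * ((n : ℕ) : ℝ) * ((j : ℕ) : ℝ) / (2 * M) : ℝ) : ℂ) * Complex.I)‖ ≤ β / (8 * Real.pi) + 1 := by
  refine (norm_sum_le _ _).trans ?_
  have : ∀ n : MatsubaraIdx M, ‖(((gnScaleCutoff 4 klE0 1 |matsubaraFreq β M n| : ℝ) : ℂ)) *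
      Complex.exp (-((2 * Real.pi * ((n : ℕ) : ℝ) * ((j : ℕ) : ℝ) / (2 * M) : ℝ) : ℂ) * Complex.I)‖ = gnScaleCutoff 4 klE0 1 |matsubaraFreq β M n| := by
    intro n
    rw [norm_mul, klct_norm_cexp_neg_real_mul_I, mul_one, Complex.norm_real, Real.norm_eq_abs, abs_of_nonneg (klct_uvCutoff_mem_Icc _).1]
  simp_rw [this]
  exact klct_sum_uvCutoff_le hβ

/-- **Support bound for the first moment**: `M₁ ≤ β(β/(8π)+1)/2` (`0 < β`; `d_{2M} ≤ M`). -/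
theorem klct_legFirstMoment_uvCut_le_support {β : ℝ} (hβ : 0 < β) :
    (((2 * M : ℕ) : ℝ))⁻¹ * ∑ j : ImagTimeIdx M, (β * min ((j : ℕ) : ℝ) (((2 * M : ℕ) : ℝ) - (j : ℕ)) / ((2 * M : ℕ) : ℝ)) *
        ‖∑ n : MatsubaraIdx M, (((gnScaleCutoff 4 klE0 1 |matsubaraFreq β M n| : ℝ) : ℂ)) *
          Complex.exp (-((2 * Real.pi * ((n : ℕ) : ℝ) * ((j : ℕ) : ℝ) / (2 * M) : ℝ) : ℂ) * Complex.I)‖ ≤ β * (β / (8 * Real.pi) + 1) / 2 := by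
  have hMne := NeZero.ne M
  have hN : (0 : ℝ) < ((2 * M : ℕ) : ℝ) := by exact_mod_cast (by omega : 0 < 2 * M)
  have hpt : ∀ j : ImagTimeIdx M, (β * min ((j : ℕ) : ℝ) (((2 * M : ℕ) : ℝ) - (j : ℕ)) / ((2 * M : ℕ) : ℝ)) *
      ‖∑ n : MatsubaraIdx M, (((gnScaleCutoff 4 klE0 1 |matsubaraFreq β M n| : ℝ) : ℂ)) *
        Complex.exp (-((2 * Real.pi * ((n : ℕ) : ℝ) * ((j : ℕ) : ℝ) / (2 * M) : ℝ) : ℂ) * Complex.I)‖ ≤ β / 2 * (β / (8 * Real.pi) + 1) := by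
    intro j
    have hd : min ((j : ℕ) : ℝ) (((2 * M : ℕ) : ℝ) - (j : ℕ)) ≤ ((2 * M : ℕ) : ℝ) / 2 := by
      rcases le_total ((j : ℕ) : ℝ) (((2 * M : ℕ) : ℝ) / 2) with h | h
      · exact (min_le_left _ _).trans h
      · exact (min_le_right _ _).trans (by linarith)
    have hw : β * min ((j : ℕ) : ℝ) (((2 * M : ℕ) : ℝ) - (j : ℕ)) / ((2 * M : ℕ) : ℝ) ≤ β / 2 := by
      rw [div_le_iff₀ hN]; nlinarith
    have hw0 : 0 ≤ β * min ((j : ℕ) : ℝ) (((2 * M : ℕ) : ℝ) - (j : ℕ)) / ((2 * M : ℕ) : ℝ) :=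
      div_nonneg (mul_nonneg hβ.le (klct_cycDist_nonneg j)) hN.le
    exact mul_le_mul hw (klct_legTransform_uvCut_le_support hβ j) (norm_nonneg _) (by positivity)
  rw [inv_mul_le_iff₀ hN]
  calc _ ≤ ∑ _j : ImagTimeIdx M, β / 2 * (β / (8 * Real.pi) + 1) := Finset.sum_le_sum (fun j _ => hpt j)
    _ = _ := by rw [Finset.sum_const, Finset.card_univ, Fintype.card_fin, nsmul_eq_mul]; ring

/-! ## §2 The number `20000` -/

/-- Arithmetic, large `β`: `113401·(β/(8π)+1)/β ≤ 4700` for `900 ≤ β`. -/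
theorem klct_numeric_moment_piece_support {β : ℝ} (hβ : 900 ≤ β) : 113401 * (β / (8 * Real.pi) + 1) / β ≤ 4700 := by
  have hβ0 : 0 < β := by linarith
  have hpi := Real.pi_gt_d4
  have hpi0 := Real.pi_pos
  have h1 : 113401 * (β / (8 * Real.pi) + 1) / β = 113401 / (8 * Real.pi) + 113401 / β := by field_simp
  rw [h1]
  have h2 : 113401 / (8 * Real.pi) ≤ 4513 := by rw [div_le_iff₀ (by positivity)]; nlinarith
  have h3 : (113401 : ℝ) / β ≤ 113401 / 900 := by gcongr
  norm_num at h3 ⊢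
  linarith

/-- Arithmetic, large `β`: `β²·C₃(β)/10752 = K₃(1.5π² + 128π³/β)/10752 ≤ 11800` for `900 ≤ β`. -/
theorem klct_numeric_moment_piece_decay {β : ℝ} (hβ : 900 ≤ β) :
    β ^ 2 * (4 * ((32 / 3) ^ 3 * 5391) * (2 * Real.pi / β) ^ 3 * (3 * β / (64 * Real.pi) + 4)) / 10752 ≤ 11800 := by
  have hβ0 : 0 < β := by linarith
  have hpi := Real.pi_lt_d4
  have hpi0 := Real.pi_pos
  have h1 : β ^ 2 * (4 * ((32 / 3) ^ 3 * 5391) * (2 * Real.pi / β) ^ 3 * (3 * β / (64 * Real.pi) + 4)) / 10752 =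
      ((32 / 3) ^ 3 * 5391) * (3 / 2 * Real.pi ^ 2 + 128 * Real.pi ^ 3 / β) / 10752 := by
    field_simp; ring
  rw [h1]
  have h2 : Real.pi ^ 2 ≤ 3.1416 ^ 2 := by gcongr
  have h3 : Real.pi ^ 3 ≤ 3.1416 ^ 3 := by gcongr
  have h4 : 128 * Real.pi ^ 3 / β ≤ 128 * 3.1416 ^ 3 / 900 := by gcongr
  norm_num at h2 h4 ⊢
  nlinarith

/-- **`M₁ ≤ 20000` UNIFORMLY IN `128 ≤ β ≤ M`** (`β ≤ 900`: support bound; `β ≥ 900`: `klct_legFirstMoment_uvCut_le` at `J = ⌈672M/β⌉`). -/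
theorem klct_legFirstMoment_uvCut_le_numeric {β : ℝ} (hβ : 128 ≤ β) (hM : β ≤ M) :
    (((2 * M : ℕ) : ℝ))⁻¹ * ∑ j : ImagTimeIdx M, (β * min ((j : ℕ) : ℝ) (((2 * M : ℕ) : ℝ) - (j : ℕ)) / ((2 * M : ℕ) : ℝ)) *
        ‖∑ n : MatsubaraIdx M, (((gnScaleCutoff 4 klE0 1 |matsubaraFreq β M n| : ℝ) : ℂ)) *
          Complex.exp (-((2 * Real.pi * ((n : ℕ) : ℝ) * ((j : ℕ) : ℝ) / (2 * M) : ℝ) : ℂ) * Complex.I)‖ ≤ 20000 := by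
  have hβ0 : 0 < β := by linarith
  have hpi0 := Real.pi_pos
  by_cases hb : β ≤ 900
  · refine (klct_legFirstMoment_uvCut_le_support hβ0).trans ?_
    have hpi := Real.pi_gt_d4
    have h1 : β / (8 * Real.pi) ≤ 900 / (8 * 3.1415) := by
      rw [div_le_div_iff₀ (by positivity) (by norm_num)]; nlinarith
    have h2 : 0 ≤ β / (8 * Real.pi) := by positivity
    norm_num at h1 ⊢
    nlinarith
  push Not at hb
  have hMr : (900 : ℝ) ≤ M := by linarith
  have hM0 : (0 : ℝ) < M := by linarith
  have hMβ : β ≤ (M : ℝ) := hM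
  set J : ℕ := ⌈(672 * (M : ℝ) / β)⌉₊ with hJdef
  set u : ℝ := 672 * (M : ℝ) / β with hu
  have hupos : 0 < u := by positivity
  have hJ1 : 1 ≤ J := Nat.succ_le_of_lt (Nat.ceil_pos.mpr hupos)
  have hJlo : u ≤ (J : ℝ) := Nat.le_ceil _
  have hJhi : (J : ℝ) < u + 1 := Nat.ceil_lt_add_one hupos.le
  have hJpos : (0 : ℝ) < J := by exact_mod_cast hJ1
  refine (klct_legFirstMoment_uvCut_le hβ hM hJ1).trans ?_
  set S : ℝ := β / (8 * Real.pi) + 1 with hS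
  set C₃ : ℝ := 4 * ((32 / 3) ^ 3 * 5391) * (2 * Real.pi / β) ^ 3 * (3 * β / (64 * Real.pi) + 4) with hC₃
  have hS0 : 0 ≤ S := by positivity
  have hC₃0 : 0 ≤ C₃ := by positivity
  have hN : ((2 * M : ℕ) : ℝ) = 2 * (M : ℝ) := by push_cast; ring
  rw [hN]
  -- split the parametric bound into the two terms
  have hsplit : β * (S * ((J : ℝ) * (J + 1)) + 2 * (C₃ * (2 * (M : ℝ)) ^ 3 / 64) / J) / (2 * (M : ℝ)) ^ 2 =
      β * S * ((J : ℝ) * (J + 1)) / (2 * (M : ℝ)) ^ 2 + β * C₃ * (2 * (M : ℝ)) / (32 * J) := by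
    field_simp; ring
  rw [hsplit]
  -- term 1
  have h1 : β * S * ((J : ℝ) * (J + 1)) / (2 * (M : ℝ)) ^ 2 ≤ 113401 * S / β := by
    have hJJ : (J : ℝ) * (J + 1) ≤ (u + 1) * (u + 2) := by nlinarith
    have step1 : β * S * ((J : ℝ) * (J + 1)) / (2 * (M : ℝ)) ^ 2 ≤ β * S * ((u + 1) * (u + 2)) / (2 * (M : ℝ)) ^ 2 := by
      gcongr
    refine step1.trans ?_
    have step2 : β * S * ((u + 1) * (u + 2)) / (2 * (M : ℝ)) ^ 2 = 112896 * S / β + 504 * S / M + β * S / (2 * (M : ℝ) ^ 2) := by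
      rw [hu]; field_simp; ring
    rw [step2]
    have e2 : 504 * S / M ≤ 504 * S / β := by gcongr
    have e3 : β * S / (2 * (M : ℝ) ^ 2) ≤ S / (2 * β) := by
      rw [div_le_div_iff₀ (by positivity) (by positivity)]
      have : β * β ≤ (M : ℝ) * M := by nlinarith
      nlinarith
    have e4 : 112896 * S / β + 504 * S / β + S / (2 * β) ≤ 113401 * S / β := by
      have : 113401 * S / β - (112896 * S / β + 504 * S / β + S / (2 * β)) = S / (2 * β) := by field_simp; ring
      have hpos : 0 ≤ S / (2 * β) := by positivity
      linarith
    linarith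
  -- term 2
  have h2 : β * C₃ * (2 * (M : ℝ)) / (32 * J) ≤ β ^ 2 * C₃ / 10752 := by
    rw [div_le_iff₀ (by positivity)]
    have : β * C₃ * (2 * (M : ℝ)) = β ^ 2 * C₃ / 10752 * (32 * u) := by rw [hu]; field_simp; ring
    rw [this]
    gcongr
  have hp1 := klct_numeric_moment_piece_support hb.le
  have hp2 := klct_numeric_moment_piece_decay hb.le
  rw [← hS] at hp1
  rw [← hC₃] at hp2
  linarith

/-! ## §3 THE TREE-WEIGHT DATUM, UNIFORMLY -/

/-- **THE FIRST-MOMENT (TREE-WEIGHT) CURRENCY OF THE UV-CUT BARE VERTEX, UNIFORMLY IN `128 ≤ β ≤ M`**: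
`ε_x³ Σ_{x′ : x′_q = y} (Σ_i (β/2M)·d_{2M}(t′_i − t′_q))·‖W₄(S_ĝ V)(x′)‖ ≤ (|U|/24)·(8·20000·15³)` (every `L`, `U`, pinned leg `q`, pin `y`). -/
theorem klbv_firstMomentCurrency_uvCut_hubbardInteraction_le_numeric [NeZero L] {β : ℝ} (hβ : 128 ≤ β) (hM : β ≤ M) (U : ℝ) (q : Fin 4)
    (y : SpaceTimeIdx L M) :
    imagTimeWeight β M ^ 3 *
        ∑ x ∈ univ.filter (fun x : Fin 4 → SpaceTimeIdx L M => x q = y),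
          (∑ i : Fin 4, β / ((2 * M : ℕ) : ℝ) * min (((((x i).1 - (x q).1 : ImagTimeIdx M)) : ℕ) : ℝ) (((2 * M : ℕ) : ℝ) - ((((x i).1 - (x q).1 : ImagTimeIdx M)) : ℕ))) *
          ‖sectorisedKernel L M β (trivialMultiplier L M)
            (ExteriorAlgebra.map (LinearMap.mulLeft ℂ (fun K : HubbardFieldIdx L M => ((gnScaleCutoff 4 klE0 1 |matsubaraFreq β M K.1.1.1| : ℝ) : ℂ))) (hubbardInteraction L M β U)) 4
            (![(((0 : Fin 1), (0 : Fin 2)), (0 : Fin 2)), ((0, 0), 1), ((0, 1), 0), ((0, 1), 1)] : Fin 4 → SectorLeg 1) x‖ ≤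
      |U| / 24 * (8 * 20000 * 15 ^ 3) := by
  refine (klbv_firstMomentCurrency_uvCut_hubbardInteraction_le (by linarith) hM U q y).trans ?_
  have hA := klct_legMass_uvCut_le_fifteen hβ hM
  have hM₁ := klct_legFirstMoment_uvCut_le_numeric hβ hM
  have hA0 : 0 ≤ (((2 * M : ℕ) : ℝ))⁻¹ * ∑ j : ImagTimeIdx M, ‖∑ n : MatsubaraIdx M, (((gnScaleCutoff 4 klE0 1 |matsubaraFreq β M n| : ℝ) : ℂ)) *
      Complex.exp (-((2 * Real.pi * ((n : ℕ) : ℝ) * ((j : ℕ) : ℝ) / (2 * M) : ℝ) : ℂ) * Complex.I)‖ :=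
    mul_nonneg (inv_nonneg.mpr (by positivity)) (Finset.sum_nonneg (fun _ _ => norm_nonneg _))
  have hM₁0 : 0 ≤ (((2 * M : ℕ) : ℝ))⁻¹ * ∑ j : ImagTimeIdx M, (β * min ((j : ℕ) : ℝ) (((2 * M : ℕ) : ℝ) - (j : ℕ)) / ((2 * M : ℕ) : ℝ)) *
        ‖∑ n : MatsubaraIdx M, (((gnScaleCutoff 4 klE0 1 |matsubaraFreq β M n| : ℝ) : ℂ)) *
          Complex.exp (-((2 * Real.pi * ((n : ℕ) : ℝ) * ((j : ℕ) : ℝ) / (2 * M) : ℝ) : ℂ) * Complex.I)‖ :=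
    mul_nonneg (inv_nonneg.mpr (by positivity)) (Finset.sum_nonneg (fun j _ =>
      mul_nonneg (div_nonneg (mul_nonneg (by linarith) (klct_cycDist_nonneg j)) (by positivity)) (norm_nonneg _)))
  gcongr

end Summit.HubbardSuperconductivity.HubbardSuperconductivity.Theorems.KLRegimeSplit

end
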